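import Literature.Analysis.FluidPDE.SawtoothCascadeDriftFree
import HarnessLib

/-!
# K3′ `K3NonlinearClosure` (aside, stmt-AnomalousDissipation-20027), line `Localised` — helpers toward STUB S5
# `stub_localisedClosure` via the landed drift-free closure: the cost asymptotics of planar slaving

The registered stub S5 of the line `Localised` concludes `PlanarAnomalousFamily` on the box from `K1LocalisedInWindow`,
`Existence` and `PlanarSlavingInWindow` (+ two toolkit lemmas).  REPAIR PATH recorded by this seat: S5 is reducible to
the LANDED drift-free closure `Theorems.SawtoothPulseCascade.DriftFreeClosure.planarAnomalousFamily_of`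
(hypotheses `K1Localised P r`, `Existence P`, `DriftFree.ApproximateSolution P r`, force bound) once
`PlanarSlaving P r ⇒ ApproximateSolution P r` is proved with the trivial approximate solution `U := V_ν` (the
Navier–Stokes solution itself, defect `ρ = 0`): its only non-trivial clause is the closeness
`∫₀^{T_A(ν)} ‖V_ν − ū‖² ≤ ε ν`, which follows from the slaving envelope
`‖V_ν(t) − ū(t)‖ ≤ K ν Σ_{i≤j} (N_i/√δ_i) M^{j−i}` on phase `j ≤ J_r(ν) + A` and the asymptotics proved HERE:

* `slavingSum_le` — `Σ_{i≤j} (N_i/√δ_i) M^{j−i} ≤ (j+1) (N₀/√δ₀) Λ^j` with `Λ = max M (ρN √d)`;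
* `nu_lt_sq_mul_pow_Jrate` — `ν < r² · (r²)^{-J_r(ν)}` for `0 < ν < 1`, `r > 1` (the ceiling in `Jrate`);
* `tendsto_nu_mul_slavingGrowth` — `ν · (J_r(ν)+A+1)² · Λ^{2(J_r(ν)+A)} → 0` as `ν → 0⁺` whenever `0 < Λ < r`
  (inside the window `M(γ²+2) < r²` one has `Λ < r`, since `γ² + 2 > M` and `r > ρN√d` on the box);
* `exists_nu_slavingGrowth_le` — its `ε`-form: `∀ ε > 0, ∃ ν₁ > 0, ∀ ν ∈ (0, ν₁], ν (J+A+1)² Λ^{2(J+A)} ≤ ε`.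

Pure real analysis on the tree's `SawtoothCascade.Jrate`; no definitions, no named facts.
-/

-- `Summit.<Summit>.<Problem>`: single-conjunct summit, the duplicate namespace segment is deliberate.
set_option linter.dupNamespace false

noncomputable section

namespace Summit.AnomalousDissipation.AnomalousDissipation.Theorems.SawtoothPulseCascade.K3NonlinearClosureLocalised

open Set Filter Topology
open Literature.Analysis.FluidPDE.SawtoothCascade

/-- The slaving sum is dominated by a single geometric rate: with `Λ = max M (ρN √d)` (`M, N₀, δ₀ ≥ 0`, `d, ρN` as in
the cascade, `N_i = N₀ ρN^i`, `δ_i = δ₀/d^i`), `Σ_{i≤j} (N_i/√δ_i) M^{j−i} ≤ (j+1) (N₀/√δ₀) Λ^j`. -/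
theorem slavingSum_le (P : CascadeParams) (hδ₀ : 0 < P.δ₀) (hd : 0 < P.d) {M : ℝ} (hM : 0 ≤ M) (j : ℕ) :
    ∑ i ∈ Finset.range (j + 1), (P.N i : ℝ) / Real.sqrt (P.δ i) * M ^ (j - i) ≤
      ((j : ℝ) + 1) * ((P.N₀ : ℝ) / Real.sqrt P.δ₀) * (max M ((P.ρN : ℝ) * Real.sqrt P.d)) ^ j := by
  set Λ : ℝ := max M ((P.ρN : ℝ) * Real.sqrt P.d) with hΛ
  have hΛM : M ≤ Λ := le_max_left _ _
  have hΛρ : (P.ρN : ℝ) * Real.sqrt P.d ≤ Λ := le_max_right _ _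
  have hΛ0 : 0 ≤ Λ := hM.trans hΛM
  have hρd0 : 0 ≤ (P.ρN : ℝ) * Real.sqrt P.d := by positivity
  have hc0 : 0 ≤ (P.N₀ : ℝ) / Real.sqrt P.δ₀ := by positivity
  -- each term is at most `(N₀/√δ₀) Λ^j`
  have hterm : ∀ i ∈ Finset.range (j + 1),
      (P.N i : ℝ) / Real.sqrt (P.δ i) * M ^ (j - i) ≤ ((P.N₀ : ℝ) / Real.sqrt P.δ₀) * Λ ^ j := by
    intro i hi
    have hij : i ≤ j := Nat.lt_succ_iff.1 (Finset.mem_range.1 hi)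
    have hN : (P.N i : ℝ) = (P.N₀ : ℝ) * (P.ρN : ℝ) ^ i := by simp [CascadeParams.N]
    have hsd : 0 < Real.sqrt P.d := Real.sqrt_pos.2 hd
    have hsδ : 0 < Real.sqrt P.δ₀ := Real.sqrt_pos.2 hδ₀
    have hpow : Real.sqrt (P.d ^ i) = Real.sqrt P.d ^ i := by
      have hsq : P.d ^ i = (Real.sqrt P.d ^ i) ^ 2 := by
        rw [← pow_mul, mul_comm, pow_mul, Real.sq_sqrt hd.le]
      rw [hsq, Real.sqrt_sq (pow_nonneg hsd.le i)]
    have hδ : Real.sqrt (P.δ i) = Real.sqrt P.δ₀ / Real.sqrt P.d ^ i := by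
      rw [CascadeParams.δ, Real.sqrt_div' _ (pow_nonneg hd.le i), hpow]
    have e : (P.N i : ℝ) / Real.sqrt (P.δ i) = ((P.N₀ : ℝ) / Real.sqrt P.δ₀) * ((P.ρN : ℝ) * Real.sqrt P.d) ^ i := by
      rw [hN, hδ, mul_pow]
      field_simp
    rw [e]
    calc ((P.N₀ : ℝ) / Real.sqrt P.δ₀) * ((P.ρN : ℝ) * Real.sqrt P.d) ^ i * M ^ (j - i)
        ≤ ((P.N₀ : ℝ) / Real.sqrt P.δ₀) * Λ ^ i * Λ ^ (j - i) := by
          gcongr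
      _ = ((P.N₀ : ℝ) / Real.sqrt P.δ₀) * Λ ^ j := by
          rw [mul_assoc, ← pow_add, Nat.add_sub_cancel' hij]
  calc ∑ i ∈ Finset.range (j + 1), (P.N i : ℝ) / Real.sqrt (P.δ i) * M ^ (j - i)
      ≤ ∑ _i ∈ Finset.range (j + 1), ((P.N₀ : ℝ) / Real.sqrt P.δ₀) * Λ ^ j := Finset.sum_le_sum hterm
    _ = ((j : ℝ) + 1) * ((P.N₀ : ℝ) / Real.sqrt P.δ₀) * Λ ^ j := by
        rw [Finset.sum_const, Finset.card_range, nsmul_eq_mul]; push_cast; ring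

/-- The ceiling in `Jrate`: for `0 < ν < 1` and `r > 1`, `ν · (r²)^{J_r(ν)} < r²`
(`J_r(ν) < log(1/ν)/(2 log r) + 1` and `r^{2·log(1/ν)/(2 log r)} = 1/ν`). -/
theorem nu_mul_pow_Jrate_lt {r ν : ℝ} (hr : 1 < r) (hν : 0 < ν) (hν1 : ν ≤ 1) :
    ν * (r ^ 2) ^ (Jrate r ν) < r ^ 2 := by
  have hlogr : 0 < Real.log r := Real.log_pos hr
  have hr0 : 0 < r := lt_trans one_pos hr
  set L : ℝ := Real.log (1 / ν) / (2 * Real.log r) with hL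
  have hL0 : 0 ≤ L := by
    have : 0 ≤ Real.log (1 / ν) := Real.log_nonneg (by rw [le_div_iff₀ hν]; linarith)
    positivity
  have hJ : (Jrate r ν : ℝ) < L + 1 := by
    simp only [Jrate]
    exact Nat.ceil_lt_add_one hL0
  -- `(r²)^J = exp (J · 2 log r) < exp ((L+1) · 2 log r) = (1/ν) · r²`
  have h1 : ((r ^ 2) ^ (Jrate r ν) : ℝ) = Real.exp ((Jrate r ν : ℝ) * (2 * Real.log r)) := by
    rw [← Real.rpow_natCast, Real.rpow_def_of_pos (by positivity), Real.log_pow]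
    push_cast
    ring_nf
  have h2 : Real.exp ((L + 1) * (2 * Real.log r)) = (1 / ν) * r ^ 2 := by
    have e : (L + 1) * (2 * Real.log r) = Real.log (1 / ν) + 2 * Real.log r := by
      rw [hL]; field_simp
    rw [e, Real.exp_add, Real.exp_log (by positivity), show (2 : ℝ) * Real.log r = Real.log (r ^ 2) by
      rw [Real.log_pow]; push_cast; ring, Real.exp_log (by positivity)]
  have h3 : ((r ^ 2) ^ (Jrate r ν) : ℝ) < (1 / ν) * r ^ 2 := by
    rw [h1, ← h2]
    exact Real.exp_lt_exp.2 (mul_lt_mul_of_pos_right hJ (by positivity))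
  calc ν * (r ^ 2) ^ (Jrate r ν) < ν * ((1 / ν) * r ^ 2) := mul_lt_mul_of_pos_left h3 hν
    _ = r ^ 2 := by field_simp

/-- `J_r(ν) → ∞` as `ν → 0⁺` (`r > 1`). -/
theorem tendsto_Jrate_atTop {r : ℝ} (hr : 1 < r) :
    Tendsto (fun ν : ℝ => Jrate r ν) (𝓝[>] 0) atTop := by
  have hlogr : 0 < 2 * Real.log r := by have := Real.log_pos hr; positivity
  have h1 : Tendsto (fun ν : ℝ => 1 / ν) (𝓝[>] 0) atTop := by
    simpa only [one_div] using tendsto_inv_nhdsGT_zero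
  have h2 : Tendsto (fun ν : ℝ => Real.log (1 / ν)) (𝓝[>] 0) atTop := Real.tendsto_log_atTop.comp h1
  have h3 : Tendsto (fun ν : ℝ => Real.log (1 / ν) / (2 * Real.log r)) (𝓝[>] 0) atTop :=
    h2.atTop_div_const hlogr
  exact tendsto_nat_ceil_atTop.comp h3

/-- **Cost asymptotics of planar slaving inside the window.** For `r > 1` and `0 < Λ < r`,
`ν · (J_r(ν) + A + 1)² · Λ^{2(J_r(ν)+A)} → 0` as `ν → 0⁺` (since `ν < r² (r²)^{-J}` and `(Λ²/r²)^J J² → 0`). -/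
theorem tendsto_nu_mul_slavingGrowth {r Λ : ℝ} (hr : 1 < r) (hΛ0 : 0 < Λ) (hΛ : Λ < r) (A : ℕ) :
    Tendsto (fun ν : ℝ => ν * ((((Jrate r ν + A + 1 : ℕ) : ℝ)) ^ 2 * Λ ^ (2 * (Jrate r ν + A))))
      (𝓝[>] 0) (𝓝 0) := by
  have hr0 : 0 < r := lt_trans one_pos hr
  set q : ℝ := Λ ^ 2 / r ^ 2 with hq
  have hq0 : 0 < q := by positivity
  have hq1 : q < 1 := by
    rw [hq, div_lt_one (by positivity)]
    exact pow_lt_pow_left₀ hΛ hΛ0.le two_ne_zero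
  -- the majorant along `n = J`: `g n = r² Λ^{2A} (n+A+1)² q^n`
  set g : ℕ → ℝ := fun n => r ^ 2 * Λ ^ (2 * A) * ((((n + A + 1 : ℕ) : ℝ)) ^ 2 * q ^ n) with hg
  have hg0 : Tendsto g atTop (𝓝 0) := by
    -- `(n+A+1)² q^n = q^{-(A+1)} · (m² q^m)` with `m = n + A + 1`
    have hm : Tendsto (fun m : ℕ => ((m : ℝ)) ^ 2 * q ^ m) atTop (𝓝 0) :=
      tendsto_pow_const_mul_const_pow_of_abs_lt_one 2 (by rw [abs_of_pos hq0]; exact hq1)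
    have hshift := hm.comp (tendsto_add_atTop_nat (A + 1))
    have e : ∀ n : ℕ, (((n + A + 1 : ℕ) : ℝ)) ^ 2 * q ^ n =
        (q ^ (A + 1))⁻¹ * ((((n + (A + 1) : ℕ) : ℝ)) ^ 2 * q ^ (n + (A + 1))) := by
      intro n
      have hqA : q ^ (A + 1) ≠ 0 := pow_ne_zero _ hq0.ne'
      rw [pow_add, show n + A + 1 = n + (A + 1) by ring]
      field_simp
      ring
    have h1 : Tendsto (fun n : ℕ => (((n + A + 1 : ℕ) : ℝ)) ^ 2 * q ^ n) atTop (𝓝 0) := by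
      have := hshift.const_mul ((q ^ (A + 1))⁻¹)
      rw [mul_zero] at this
      refine this.congr fun n => ?_
      simp only [Function.comp] 
      exact (e n).symm
    have := h1.const_mul (r ^ 2 * Λ ^ (2 * A))
    rw [mul_zero] at this
    exact this
  have hgJ := hg0.comp (tendsto_Jrate_atTop hr)
  -- squeeze on `(0, 1]`
  have hev1 : ∀ᶠ ν in 𝓝[>] (0 : ℝ), 0 < ν := eventually_nhdsWithin_of_forall fun ν hν => hν
  have hev2 : ∀ᶠ ν in 𝓝[>] (0 : ℝ), ν < 1 :=
    nhdsWithin_le_nhds (Iio_mem_nhds (by norm_num : (0 : ℝ) < 1))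
  refine tendsto_of_tendsto_of_tendsto_of_le_of_le' tendsto_const_nhds hgJ ?_ ?_
  · filter_upwards [hev1] with ν hν
    positivity
  · filter_upwards [hev1, hev2] with ν hν hν1
    have hkey := nu_mul_pow_Jrate_lt hr hν hν1.le
    set J := Jrate r ν with hJ
    -- `ν Λ^{2(J+A)} (J+A+1)² ≤ r² Λ^{2A} (J+A+1)² q^J`
    have hΛpow : Λ ^ (2 * (J + A)) = Λ ^ (2 * A) * (q ^ J * (r ^ 2) ^ J) := by
      have e : q ^ J * (r ^ 2) ^ J = Λ ^ (2 * J) := by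
        rw [hq, div_pow, ← pow_mul, div_mul_cancel₀ _ (pow_ne_zero _ (by positivity))]
      rw [e]; ring
    show ν * ((((J + A + 1 : ℕ) : ℝ)) ^ 2 * Λ ^ (2 * (J + A))) ≤ g J
    rw [hg, hΛpow]
    simp only
    have hsq : 0 ≤ (((J + A + 1 : ℕ) : ℝ)) ^ 2 := by positivity
    have hqJ : 0 ≤ q ^ J := by positivity
    have hΛA : 0 ≤ Λ ^ (2 * A) := by positivity
    calc ν * ((((J + A + 1 : ℕ) : ℝ)) ^ 2 * (Λ ^ (2 * A) * (q ^ J * (r ^ 2) ^ J)))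
        = (ν * (r ^ 2) ^ J) * (Λ ^ (2 * A) * ((((J + A + 1 : ℕ) : ℝ)) ^ 2 * q ^ J)) := by ring
      _ ≤ r ^ 2 * (Λ ^ (2 * A) * ((((J + A + 1 : ℕ) : ℝ)) ^ 2 * q ^ J)) :=
          mul_le_mul_of_nonneg_right hkey.le (by positivity)
      _ = r ^ 2 * Λ ^ (2 * A) * ((((J + A + 1 : ℕ) : ℝ)) ^ 2 * q ^ J) := by ring

/-- `ε`-form of the cost asymptotics: for every `ε > 0` there is `ν₁ > 0` such that
`ν (J_r(ν)+A+1)² Λ^{2(J_r(ν)+A)} ≤ ε` for all `ν ∈ (0, ν₁]`. -/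
theorem exists_nu_slavingGrowth_le {r Λ : ℝ} (hr : 1 < r) (hΛ0 : 0 < Λ) (hΛ : Λ < r) (A : ℕ) {ε : ℝ}
    (hε : 0 < ε) :
    ∃ ν₁ : ℝ, 0 < ν₁ ∧ ∀ ν ∈ Ioc 0 ν₁,
      ν * ((((Jrate r ν + A + 1 : ℕ) : ℝ)) ^ 2 * Λ ^ (2 * (Jrate r ν + A))) ≤ ε := by
  have h := tendsto_nu_mul_slavingGrowth hr hΛ0 hΛ A
  have hev : ∀ᶠ ν in 𝓝[>] (0 : ℝ),
      ν * ((((Jrate r ν + A + 1 : ℕ) : ℝ)) ^ 2 * Λ ^ (2 * (Jrate r ν + A))) < ε :=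
    (tendsto_order.1 h).2 ε hε
  rw [eventually_nhdsWithin_iff, Metric.eventually_nhds_iff] at hev
  obtain ⟨δ, hδ, hδε⟩ := hev
  refine ⟨δ / 2, by positivity, fun ν hν => le_of_lt (hδε ?_ hν.1)⟩
  rw [Real.dist_eq, sub_zero, abs_of_pos hν.1]
  linarith [hν.2]

end Summit.AnomalousDissipation.AnomalousDissipation.Theorems.SawtoothPulseCascade.K3NonlinearClosureLocalised

end
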